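import Summits.AtomisticToContinuum.Crystallization.Theorems.FrustratedLawDichotomyStrainedPatchHomEntryLeafHTA2QSq
import Summits.AtomisticToContinuum.Crystallization.Theorems.FrustratedLawDichotomyStrainedPatchHomEntryLeafHTA2QS

/-!
# The production leaf verdict v3 (sharp third-order remainder on the certificate side, squared inner pair test): leaf, containment of v2, soundness, consumer
# (27623 `(H) HomFloor (1/625)`, hcp half; hand-1 g37; critic rows 1368 (2) / 1408 (4))

decomp-a2c hand-1 g37 (crux `AperiodicFrustratedLawGap`, stmt-AtomisticToContinuum-27623).  VERBATIM `…HomEntryLeafHTA2QSq` one level up: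
* `entryLeafOKHT4A2QSQDCRS μ q p Q Gn J t := entryLeafOKHT4A2QS (entryLeafOKHQDCRS μ q) p Q Gn J t` — the slab leaf whose certificate side uses the SHARP
  third-order remainder `rem3LJS` (`…HomSlopeLJAffine2KitS/ThirdSharp/Affine2QS/EntryLeafHTA2QS`) and whose inner verdict is the squared pair test; ★★ `_sound`;
* the production verdict v3 `entryLeafOKHT4A2QQDCRS3 μ := decide (∃ payloads, entryLeafOKHT4A2QSQDCRS …) ∨ entryLeafOKHT4A2QQDCRSE μ` (CONTAINS v2, hence v1 and
  the union verdict of record: every landed cell / tree / glue stays valid): `_of_certS3`, `_of_SE`, ★ `treeOK_HT4A2QQDCRS3_of_SE`, ★★ `_sound`,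
  ★★ `hcpHalf_of_entryTreeHT4A2QQDCRS3`, ★★★ `homFloor_625_of_entryTrees6RBKP_HT4A2QQDCRS3` (the consumer), leaf currency `exists_tree_HT4A2QQDCRS3_of_certS3`,
  `exists_treeOK_HT4A2QQDCRS3_of_SE`.
Effect of v3 over v2 (hand-1 g37 kernel probe M1): per-cell slope constant `Gs` −52 %/−39 %/−31 % (B9/B08M/B385) ⇒ slab constant `t` −21 %/−11 %/−8 % ⇒
confinement radii `r` idem ⇒ smaller confined boxes for the inner verdict at the same certificate cost.

Two definitions (`entryLeafOKHT4A2QSQDCRS` computable, `entryLeafOKHT4A2QQDCRS3` classical) + soundness; 0 sorry; standard axioms; no instances / notation /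
`#eval`.  `--supports stmt-AtomisticToContinuum-27623`.
-/

noncomputable section

namespace Summit.AtomisticToContinuum.Crystallization.Theorems.FrustratedLawDichotomyStrainedPatchHomEntryLeafHT

open scoped BigOperators RealInnerProductSpace
open Literature.Analysis.ValidatedNumerics.Numerics
open Summit.AtomisticToContinuum.Crystallization.Theorems.ChargedEnergyGapNegative (E3)
open Summit.AtomisticToContinuum.Crystallization.Theorems.FrustratedLawDichotomySchurCut (effPot w₄₅ ω₄)
open Summit.AtomisticToContinuum.Crystallization.Theorems.FrustratedLawDichotomyAveragingRuleTightFree (TightNearCap BadNearCap)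
open Summit.AtomisticToContinuum.Crystallization.Theorems.FrustratedLawDichotomyExemptAbsorption (ExemptNear)
open Summit.AtomisticToContinuum.Crystallization.Theorems.FrustratedLawDichotomyStrainedPatchHomSplit (ExRec latPt hexFrame hcpShift HomFloor)
open Summit.AtomisticToContinuum.Crystallization.Theorems.FrustratedLawDichotomyStrainedPatchHomCurvLeafHCC (entryLeafOKHCCX entryLeafOKHCCX_sound)
open Summit.AtomisticToContinuum.Crystallization.Theorems.FrustratedLawDichotomyStrainedPatchHomPrunedPolar (homFloor_of_prunedBoxSums_selfAdjoint)
open Summit.AtomisticToContinuum.Crystallization.Theorems.FrustratedLawDichotomyStrainedPatchHomCertTree (CertTree treeOK)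
open Summit.AtomisticToContinuum.Crystallization.Theorems.FrustratedLawDichotomyStrainedPatchHomEntryGram (rootC rootW)
open Summit.AtomisticToContinuum.Crystallization.Theorems.FrustratedLawDichotomyStrainedPatchHomEntryGramHcp (rootCH rootWH)
open Summit.AtomisticToContinuum.Crystallization.Theorems.FrustratedLawDichotomyStrainedPatchHomEntryTable (muRec muRec_ok)
open Summit.AtomisticToContinuum.Crystallization.Theorems.FrustratedLawDichotomyStrainedPatchHomEntryTableP (entryLeafOK6RBKP)
open Summit.AtomisticToContinuum.Crystallization.Theorems.FrustratedLawDichotomyStrainedPatchHomEntryTreeCert (fccHalf_of_entryTree6RBKP)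
open Summit.AtomisticToContinuum.Crystallization.Theorems.FrustratedLawDichotomyStrainedPatchHomEntryFlipHcp (HcpDich hcpHalf_of_entryTreeShuf)
open Summit.AtomisticToContinuum.Crystallization.Theorems.FrustratedLawDichotomyStrainedPatchHomEntryFitHcpCentred (entryLeafOKHQDCRS entryLeafOKHQDCRS_sound)


/-! ## §1. The slab leaf with the sharp certificate side and the squared inner test -/

/-- ★ **THE SLAB LEAF v3**: sharp third-order remainder on the certificate side (`entryLeafOKHT4A2QS`), squared inner pair test (`entryLeafOKHQDCRS μ q`). -/
def entryLeafOKHT4A2QSQDCRS (μ : ℤ) (q : Fin 4 → ℤ) (p : HTCert) (Q : Fin 3 → ℤ) (Gn : ℤ) (J : Fin 3 → Fin 3 × Fin 3 → ℤ)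
    (t : CertTree ((Fin 3 × Fin 3) ⊕ Fin 3)) (c w : (Fin 3 × Fin 3) ⊕ Fin 3 → ℤ) : Bool :=
  entryLeafOKHT4A2QS (entryLeafOKHQDCRS μ q) p Q Gn J t c w

/-- ★★ Soundness of `entryLeafOKHT4A2QSQDCRS` in the hver shape. [folklore chaining: `entryLeafOKHT4A2QS_sound` with `entryLeafOKHQDCRS_sound`] -/
theorem entryLeafOKHT4A2QSQDCRS_sound {μ : ℤ} {q : Fin 4 → ℤ} {p : HTCert} {Q : Fin 3 → ℤ} {Gn : ℤ} {J : Fin 3 → Fin 3 × Fin 3 → ℤ}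
    {t : CertTree ((Fin 3 × Fin 3) ⊕ Fin 3)} {c w : (Fin 3 × Fin 3) ⊕ Fin 3 → ℤ} (h : entryLeafOKHT4A2QSQDCRS μ q p Q Gn J t c w = true) (U : E3 →L[ℝ] E3) (ξ : E3)
    (hsa : ∀ v v' : E3, ⟪U v, v'⟫ = ⟪v, U v'⟫) (hU : ‖U - 1‖ ≤ 1 / 4)
    (hbox : ∀ ab : Fin 3 × Fin 3, |(U (EuclideanSpace.single ab.2 (1 : ℝ))) ab.1 - (c (Sum.inl ab) : ℝ) / SC| ≤ (w (Sum.inl ab) : ℝ) / SC)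
    (hξ : ∀ i : Fin 3, |ξ i - (c (Sum.inr i) : ℝ) / SC| ≤ (w (Sum.inr i) : ℝ) / SC) (h0 : 0 ≤ ξ 0) (h2 : 0 ≤ ξ 2) :
    (∀ (M : ℕ) (z : Fin M → E3) (cc : Fin M), Function.Injective z →
        Set.range z = {x : E3 | dist x (z cc) ≤ 133 / 10 ∧ ∃ a : Fin 3 → ℤ,
          x = z cc + latPt U hexFrame a ∨ x = z cc + latPt U hexFrame a + U (hcpShift + ξ)} →
        TightNearCap (9 / 5) (3 / 2) z cc ∨ ExemptNear (9 / 5) ExRec z cc ∨ BadNearCap (9 / 5) (3 / 2) z cc) ∨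
      (μ : ℝ) / SC ≤ ∑ b ∈ (Fintype.piFinset fun _ : Fin 3 => Finset.Icc (-7 : ℤ) 7).filter (fun b => b ≠ 0), effPot w₄₅ ω₄ (3 / 400) ‖latPt U hexFrame b‖ +
        ∑ b ∈ (Fintype.piFinset fun _ : Fin 3 => Finset.Icc (-7 : ℤ) 7), effPot w₄₅ ω₄ (3 / 400) ‖latPt U hexFrame b + U (hcpShift + ξ)‖ :=
  entryLeafOKHT4A2QS_sound (fun c' w' hv V η hVsa hV1 hVb hη h0' h2' => entryLeafOKHQDCRS_sound c' w' hv V η hVsa hV1 hVb hη h0' h2') h U ξ hsa hU hbox hξ h0 h2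

/-! ## §2. The production verdict v3: definition, leaf lemmas, containment of v2, soundness, consumer -/

/-- ★ **THE PRODUCTION LEAF VERDICT, v3**: some payload passes the sharp-certificate slab leaf, else the production verdict v2 `entryLeafOKHT4A2QQDCRSE μ`. -/
noncomputable def entryLeafOKHT4A2QQDCRS3 (μ : ℤ) (c w : (Fin 3 × Fin 3) ⊕ Fin 3 → ℤ) : Bool :=
  @decide (∃ (q : Fin 4 → ℤ) (p : HTCert) (Q : Fin 3 → ℤ) (Gn : ℤ) (J : Fin 3 → Fin 3 × Fin 3 → ℤ) (t : CertTree ((Fin 3 × Fin 3) ⊕ Fin 3)),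
      entryLeafOKHT4A2QSQDCRS μ q p Q Gn J t c w = true) (Classical.propDecidable _) || entryLeafOKHT4A2QQDCRSE μ c w

/-- ★ A cell certified with EXPLICIT payloads under the sharp-certificate slab leaf passes v3. [formal bookkeeping] -/
theorem entryLeafOKHT4A2QQDCRS3_of_certS3 {μ : ℤ} {q : Fin 4 → ℤ} {p : HTCert} {Q : Fin 3 → ℤ} {Gn : ℤ} {J : Fin 3 → Fin 3 × Fin 3 → ℤ}
    {t : CertTree ((Fin 3 × Fin 3) ⊕ Fin 3)} {c w : (Fin 3 × Fin 3) ⊕ Fin 3 → ℤ} (h : entryLeafOKHT4A2QSQDCRS μ q p Q Gn J t c w = true) :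
    entryLeafOKHT4A2QQDCRS3 μ c w = true := by
  unfold entryLeafOKHT4A2QQDCRS3
  rw [Bool.or_eq_true]
  exact Or.inl (@decide_eq_true _ (Classical.propDecidable _) ⟨q, p, Q, Gn, J, t, h⟩)

/-- CONTAINMENT at the leaf: the production verdict v2 implies v3. [formal bookkeeping] -/
theorem entryLeafOKHT4A2QQDCRS3_of_SE {μ : ℤ} {c w : (Fin 3 × Fin 3) ⊕ Fin 3 → ℤ} (h : entryLeafOKHT4A2QQDCRSE μ c w = true) :
    entryLeafOKHT4A2QQDCRS3 μ c w = true := by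
  unfold entryLeafOKHT4A2QQDCRS3
  rw [Bool.or_eq_true]
  exact Or.inr h

/-- ★ CONTAINMENT for whole certificate trees: a tree accepted by v2 is accepted by v3. [formal bookkeeping] -/
theorem treeOK_HT4A2QQDCRS3_of_SE {μ : ℤ} {t : CertTree ((Fin 3 × Fin 3) ⊕ Fin 3)} {c w : (Fin 3 × Fin 3) ⊕ Fin 3 → ℤ}
    (h : treeOK (entryLeafOKHT4A2QQDCRSE μ) t c w = true) : treeOK (entryLeafOKHT4A2QQDCRS3 μ) t c w = true :=
  treeOK_mono (fun _ _ h' => entryLeafOKHT4A2QQDCRS3_of_SE h') t c w h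

/-- ★★ Soundness of `entryLeafOKHT4A2QQDCRS3` in the hver shape. [folklore chaining: a classical witness feeds `entryLeafOKHT4A2QSQDCRS_sound`; the other
disjunct is `entryLeafOKHT4A2QQDCRSE_sound`] -/
theorem entryLeafOKHT4A2QQDCRS3_sound {μ : ℤ} {c w : (Fin 3 × Fin 3) ⊕ Fin 3 → ℤ} (h : entryLeafOKHT4A2QQDCRS3 μ c w = true) (U : E3 →L[ℝ] E3) (ξ : E3)
    (hsa : ∀ v v' : E3, ⟪U v, v'⟫ = ⟪v, U v'⟫) (hU : ‖U - 1‖ ≤ 1 / 4)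
    (hbox : ∀ ab : Fin 3 × Fin 3, |(U (EuclideanSpace.single ab.2 (1 : ℝ))) ab.1 - (c (Sum.inl ab) : ℝ) / SC| ≤ (w (Sum.inl ab) : ℝ) / SC)
    (hξ : ∀ i : Fin 3, |ξ i - (c (Sum.inr i) : ℝ) / SC| ≤ (w (Sum.inr i) : ℝ) / SC) (h0 : 0 ≤ ξ 0) (h2 : 0 ≤ ξ 2) :
    (∀ (M : ℕ) (z : Fin M → E3) (cc : Fin M), Function.Injective z →
        Set.range z = {x : E3 | dist x (z cc) ≤ 133 / 10 ∧ ∃ a : Fin 3 → ℤ,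
          x = z cc + latPt U hexFrame a ∨ x = z cc + latPt U hexFrame a + U (hcpShift + ξ)} →
        TightNearCap (9 / 5) (3 / 2) z cc ∨ ExemptNear (9 / 5) ExRec z cc ∨ BadNearCap (9 / 5) (3 / 2) z cc) ∨
      (μ : ℝ) / SC ≤ ∑ b ∈ (Fintype.piFinset fun _ : Fin 3 => Finset.Icc (-7 : ℤ) 7).filter (fun b => b ≠ 0), effPot w₄₅ ω₄ (3 / 400) ‖latPt U hexFrame b‖ +
        ∑ b ∈ (Fintype.piFinset fun _ : Fin 3 => Finset.Icc (-7 : ℤ) 7), effPot w₄₅ ω₄ (3 / 400) ‖latPt U hexFrame b + U (hcpShift + ξ)‖ := by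
  unfold entryLeafOKHT4A2QQDCRS3 at h
  rw [Bool.or_eq_true] at h
  rcases h with h | h
  · obtain ⟨q, p, Q, Gn, J, t, ht⟩ := @of_decide_eq_true _ (Classical.propDecidable _) h
    exact entryLeafOKHT4A2QSQDCRS_sound ht U ξ hsa hU hbox hξ h0 h2
  · exact entryLeafOKHT4A2QQDCRSE_sound h U ξ hsa hU hbox hξ h0 h2

/-- ★★ The hcp half from ONE certificate tree over `entryLeafOKHT4A2QQDCRS3 μ`. [folklore chaining] -/
theorem hcpHalf_of_entryTreeHT4A2QQDCRS3 {m : ℝ} {μ : ℤ} (hμ : 2 * (m + (-(7175 / 10000) + 3 / 400)) * SC ≤ μ)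
    {t : CertTree ((Fin 3 × Fin 3) ⊕ Fin 3)} (h : treeOK (entryLeafOKHT4A2QQDCRS3 μ) t rootCH rootWH = true) :
    ∀ (U : E3 →L[ℝ] E3) (ξ : E3), (∀ v w : E3, inner ℝ (U v) w = inner ℝ v (U w)) → (∀ w : E3, 0 ≤ inner ℝ w (U w)) →
      ‖U - 1‖ ≤ 1 / 4 → ‖ξ‖ ≤ 1 / 4 → HcpDich m U ξ :=
  hcpHalf_of_entryTreeShuf hμ (entryLeafOKHT4A2QQDCRS3 μ) (fun _ _ hv U ξ hsa hU hbox hξ h0 h2 => entryLeafOKHT4A2QQDCRS3_sound hv U ξ hsa hU hbox hξ h0 h2) h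

/-- ★★★ **`(H) HomFloor (1/625)` FROM THE fcc ∃-TREE AND ONE hcp ∃-TREE OVER THE PRODUCTION VERDICT v3** (`μ = muRec`). [folklore] -/
theorem homFloor_625_of_entryTrees6RBKP_HT4A2QQDCRS3
    (hF : ∃ t : CertTree (Fin 3 × Fin 3), treeOK (entryLeafOK6RBKP muRec) t rootC rootW = true)
    (hH : ∃ t : CertTree ((Fin 3 × Fin 3) ⊕ Fin 3), treeOK (entryLeafOKHT4A2QQDCRS3 muRec) t rootCH rootWH = true) : HomFloor (1 / 625) := by
  obtain ⟨tF, htF⟩ := hF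
  obtain ⟨tH, htH⟩ := hH
  exact homFloor_of_prunedBoxSums_selfAdjoint (fccHalf_of_entryTree6RBKP muRec_ok htF) (hcpHalf_of_entryTreeHT4A2QQDCRS3 muRec_ok htH)

/-- ★★★ CONTAINMENT at the consumer: the `hH` hypothesis of the v2 consumer yields the `hH` hypothesis of the v3 consumer. [formal bookkeeping] -/
theorem exists_treeOK_HT4A2QQDCRS3_of_SE {μ : ℤ} {c w : (Fin 3 × Fin 3) ⊕ Fin 3 → ℤ}
    (hH : ∃ t : CertTree ((Fin 3 × Fin 3) ⊕ Fin 3), treeOK (entryLeafOKHT4A2QQDCRSE μ) t c w = true) :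
    ∃ t : CertTree ((Fin 3 × Fin 3) ⊕ Fin 3), treeOK (entryLeafOKHT4A2QQDCRS3 μ) t c w = true := by
  obtain ⟨t, ht⟩ := hH
  exact ⟨t, treeOK_HT4A2QQDCRS3_of_SE ht⟩

/-- ★ LEAF CURRENCY: a cell certified with explicit payloads under the sharp-certificate slab leaf IS a one-leaf ∃-tree over v3. [formal bookkeeping] -/
theorem exists_tree_HT4A2QQDCRS3_of_certS3 {μ : ℤ} {q : Fin 4 → ℤ} {p : HTCert} {Q : Fin 3 → ℤ} {Gn : ℤ} {J : Fin 3 → Fin 3 × Fin 3 → ℤ}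
    {t : CertTree ((Fin 3 × Fin 3) ⊕ Fin 3)} {c w : (Fin 3 × Fin 3) ⊕ Fin 3 → ℤ} (h : entryLeafOKHT4A2QSQDCRS μ q p Q Gn J t c w = true) :
    ∃ t' : CertTree ((Fin 3 × Fin 3) ⊕ Fin 3), treeOK (entryLeafOKHT4A2QQDCRS3 μ) t' c w = true :=
  ⟨.leaf, entryLeafOKHT4A2QQDCRS3_of_certS3 h⟩

/-- LEAF CURRENCY for a cell certified under v2 (hence under every earlier verdict). [formal bookkeeping] -/
theorem exists_tree_HT4A2QQDCRS3_of_SE {μ : ℤ} {c w : (Fin 3 × Fin 3) ⊕ Fin 3 → ℤ} (h : entryLeafOKHT4A2QQDCRSE μ c w = true) :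
    ∃ t' : CertTree ((Fin 3 × Fin 3) ⊕ Fin 3), treeOK (entryLeafOKHT4A2QQDCRS3 μ) t' c w = true :=
  ⟨.leaf, entryLeafOKHT4A2QQDCRS3_of_SE h⟩

end Summit.AtomisticToContinuum.Crystallization.Theorems.FrustratedLawDichotomyStrainedPatchHomEntryLeafHT
end
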